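import Literature.NumberTheory.EllipticCurves.KernelReductionTateFormInertiaProofs
import Literature.NumberTheory.EllipticCurves.KernelReductionOrdinaryTwoProofs
import HarnessLib

/-!
# `2 • (τ - 1) E[ℓᵐ]` is small at a potentially multiplicative place above `ℓ`, for every prime `ℓ`

`Proofs` file (theorems only, no definitions, no named facts), topic `NumberTheory/EllipticCurves`.
The parity-free sequel of `KernelReductionTateFormTorsionProofs` /
`KernelReductionTateFormInertiaProofs` (which assume `ℓ` odd): on a Tate form of residue
characteristic `ℓ` an isometry `σ` need not move a *middle* point `P` of `2`-power order
(`|x(P)|² ≤ |a₆|`: on `E_q` the points `φ(u)` with `v(u) = v(q)/2`, the component of order `2` of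
`E_q/E_{q,0} ≅ ℤ/v(q)ℤ`) into the kernel of reduction, but it always moves `2P ∈ E₀`
(`TateForm.not_isSmall_two_nsmul_of_middle`, Silverman *ATAEC* V.4 Lemma 4.1.4) into it; so
**`2 • (P^σ - P)` lies in `E₁ ∪ {O}` for every point `P` of `ℓ`-power order and every
isometry `σ`, for every prime `ℓ`** (`TateForm.one_lt_valuation_of_two_zsmul_map_sub_eq_some`).
Consequently, for an elliptic curve `E` over a number field `K`, a prime `ℓ` (now including
`ℓ = 2`) and a place `v ∣ ℓ` with `ord_v(j(E)) < 0`, **there is `τ ∈ Γ_K` with `χ_ℓ(τ) ≠ 1` and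
`#((τ - 1) E[ℓᵐ]) ≤ ℓ^{m + 2}` for all `m`**
(`WeierstrassCurve.exists_cyclotomicCharacter_ne_one_card_map_smul_sub_le_pow_add_two_of_one_lt_valuation_j`):
the doubles of `(τ - 1) E[ℓᵐ]`, transported to the Tate form of invariant `j(E)` over `K_v` as in
`KernelReductionTateFormInertiaProofs`, form a subgroup of the kernel of reduction killed by
`ℓᵐ`, of order `≤ ℓᵐ` by the kernel-of-reduction count (`TateForm.card_addSubgroup_le_pow` for
odd `ℓ`, the Hasse invariant `A_ℓ` of a Tate form being a unit; `card_addSubgroup_le_two_pow_of_a₁`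
for `ℓ = 2`, the Hasse invariant `a₁ = 1`), and doubling on `(τ - 1) E[ℓᵐ]` has kernel inside
`E[2]`, of order `4 ≤ ℓ²`.  This is the finite-level content of Serre, *Abelian ℓ-adic
representations* (1968), IV, A.1.2–A.1.3 (at a place of potentially multiplicative reduction the
Tate module is, over an open subgroup of the decomposition group, an extension of `ℤ_ℓ` by
`ℤ_ℓ(1)`), for all `ℓ`, obtained without the Tate curve.

## References

* [SerreAbelianLadic1968] J.-P. Serre, *Abelian ℓ-adic representations and elliptic curves*
  (1968), Ch. IV, A.1.2–A.1.3 and §2.2.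
* [SilvermanAEC2009] J. H. Silverman, *The Arithmetic of Elliptic Curves*, 2nd ed., VII.2.1,
  III.2.5, VII.3.1, X.5.4.
* [SilvermanATAEC1994] J. H. Silverman, *Advanced Topics*, V.4, Lemmas 4.1.1–4.1.4, Cor. IV.9.2(d).

## Design

Theorems only; `noncomputable section`, `open scoped Classical NNReal`, one universe `u`.  The
local theorem follows `TateForm.one_lt_valuation_of_map_sub_eq_some_of_zsmul_eq_zero` case by case
(kernel of reduction / non-middle small point on a branch / middle point), working on the
`𝒪_w`-model `M` of the Tate form through `Affine.Point.congrEquiv`; the number-field theorem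
follows `exists_cyclotomicCharacter_ne_one_card_map_smul_sub_le_of_one_lt_valuation_j` line by
line, inserting the doubling `zsmulAddGroupHom 2` before the transport.
-/

noncomputable section

open scoped Classical NNReal NumberField Pointwise
open NumberField IsDedekindDomain Field

universe u

namespace Literature.NumberTheory.EllipticCurves

namespace TateForm

-- `_root_`: the import closure declares `Literature.NumberTheory.EllipticCurves.WeierstrassCurve.*`
open _root_.WeierstrassCurve

variable {L : Type u} [Field L] {w : Valuation L ℝ≥0}

/-- On the `𝒪_w`-model of a Tate form of residue characteristic `ℓ`, a point of `ℓ`-power order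
which is not small (i.e. lies in `E₀`) reduces to `Õ`: `E₀ ∩ T[ℓ^∞] ⊆ E₁ ∪ {O}`
(`reducesToZero_of_hasNonsingularReduction_of_zsmul_eq_zero`: its image in `κˣ` is an `ℓᵐ`-th
root of unity in characteristic `ℓ`). [cite: SilvermanAEC2009, Prop. VII.2.1 and III.2.5(a)] -/
theorem reducesToZero_of_not_isSmall_of_zsmul_eq_zero {M : WeierstrassCurve w.integer}
    (hT : IsTateForm w (M.baseChange L)) {ℓ : ℕ} [hℓ : Fact ℓ.Prime] (hℓw : w ℓ < 1) {m : ℕ}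
    {P : (M.baseChange L).toAffine.Point} (hP : ¬ IsSmall w P)
    (hPm : ((ℓ ^ m : ℕ) : ℤ) • P = 0) : M.ReducesToZero P := by
  have hns : M.HasNonsingularReduction P := by
    have := (isSmall_iff_not_hasNonsingularReduction hT P).not.mp hP
    rwa [not_not] at this
  exact reducesToZero_of_hasNonsingularReduction_of_zsmul_eq_zero hT hℓw hns hPm

/-- Transport to the `𝒪_w`-model: for `W_L = M_L` in Tate form of residue characteristic `ℓ`, a
point `Q ∈ W(L)` of `ℓ`-power order which is not small is carried by `congrEquiv` to a point of
`M(L)` reducing to `Õ`. [cite: SilvermanAEC2009, Prop. VII.2.1] -/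
theorem reducesToZero_congrEquiv_of_not_isSmall {F : Type*} [Field F] [Algebra F L]
    {W : WeierstrassCurve F} {M : WeierstrassCurve w.integer}
    (hM : W.baseChange L = M.baseChange L) (hT : IsTateForm w (M.baseChange L))
    {ℓ : ℕ} [hℓ : Fact ℓ.Prime] (hℓw : w ℓ < 1) {m : ℕ}
    {Q : (W.baseChange L).toAffine.Point} (hQ : ¬ IsSmall w Q)
    (hQm : ((ℓ ^ m : ℕ) : ℤ) • Q = 0) :
    M.ReducesToZero (Affine.Point.congrEquiv hM Q) := by
  have hQm' : ((ℓ ^ m : ℕ) : ℤ) • Affine.Point.congrEquiv hM Q = 0 := by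
    rw [← map_zsmul, hQm, map_zero]
  rcases Q with _ | ⟨x, y, h⟩
  · rw [← Affine.Point.zero_def, map_zero]
    exact WeierstrassCurve.reducesToZero_zero
  · rw [Affine.Point.congrEquiv_some hM] at hQm' ⊢
    refine reducesToZero_of_not_isSmall_of_zsmul_eq_zero hT hℓw ?_ hQm'
    rw [isSmall_some] at hQ ⊢
    exact hQ

/-- Transport to the `𝒪_w`-model: an affine point `(x, y) ∈ W(L)` with `|x| > 1` is carried by
`congrEquiv` to a point of `M(L)` reducing to `Õ`. [folklore] -/
theorem reducesToZero_congrEquiv_some_of_one_lt {F : Type*} [Field F] [Algebra F L]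
    {W : WeierstrassCurve F} {M : WeierstrassCurve w.integer}
    (hM : W.baseChange L = M.baseChange L) {x y : L} (h : (W.baseChange L).toAffine.Nonsingular x y)
    (hx : 1 < w x) : M.ReducesToZero (Affine.Point.congrEquiv hM (.some x y h)) := by
  rw [Affine.Point.congrEquiv_some hM, WeierstrassCurve.reducesToZero_some_iff,
    not_mem_range_iff (Valuation.integer.integers w)]
  exact hx

/-- **On a Tate form of residue characteristic `ℓ` (any prime), every isometry moves the doubles
of the points of `ℓ`-power order into the kernel of reduction.**  Let `W/F` be a Weierstrass
equation with `W_L` in Tate form for `w` (`a₆ ≠ 0`), `w ℓ < 1`, `σ ∈ Aut(L/F)` with `w ∘ σ = w`,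
and `P ∈ W(L)` with `ℓᵐ • P = O`.  If `2 • (P^σ - P) = (s, t)` is affine then `w s > 1`.
Cases: `P ∈ E₁` (`|x| > 1`): so is `P^σ`, and `E₁ ∪ {O}` is a subgroup; `P` integral: then
`P` is small (a point of `E₀ ∖ E₁` of `ℓ`-power order does not exist), and either non-middle
(`|a₆| < |x|²`) — then `P`, `P^σ` lie on the same branch at the same level and `P^σ - P ∈ E₀`
is of `ℓ`-power order, hence in `E₁ ∪ {O}` (as for odd `ℓ`) — or middle (`|x|² ≤ |a₆|`) — then
`2P ∈ E₀` (`not_isSmall_two_nsmul_of_middle`) and `2P^σ ∈ E₀` are of `ℓ`-power order, hence in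
`E₁ ∪ {O}`, and so is their difference `2 • (P^σ - P)`.
[cite: SilvermanATAEC1994, V.4 Lemmas 4.1.2 and 4.1.4, Cor. IV.9.2(d)]
[cite: SerreAbelianLadic1968, IV A.1.2] -/
theorem one_lt_valuation_of_two_zsmul_map_sub_eq_some {F : Type*} [Field F] [Algebra F L]
    (W : WeierstrassCurve F) [hint : (W.baseChange L).IsIntegral w.integer]
    (hT : IsTateForm w (W.baseChange L)) (ha₆ : (W.baseChange L).a₆ ≠ 0)
    {ℓ : ℕ} [hℓ : Fact ℓ.Prime] (hℓw : w ℓ < 1)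
    (σ : L ≃ₐ[F] L) (hσ : ∀ z, w (σ z) = w z) {m : ℕ}
    (P : (W.baseChange L).toAffine.Point) (hPm : ((ℓ ^ m : ℕ) : ℤ) • P = 0)
    {s t : L} {hst : (W.baseChange L).toAffine.Nonsingular s t}
    (hE : (2 : ℤ) • (Affine.Point.map (σ : L →ₐ[F] L) P - P) = .some s t hst) : 1 < w s := by
  obtain ⟨M, hM⟩ := hint.integral
  have hv := Valuation.integer.integers w
  have hT' : IsTateForm w (M.baseChange L) := hM ▸ hT
  set e := Affine.Point.congrEquiv hM with he
  -- it suffices to show that `2 • (P^σ - P)` reduces to `Õ` on the model `M`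
  suffices hred : M.ReducesToZero (e ((2 : ℤ) • (Affine.Point.map (σ : L →ₐ[F] L) P - P))) by
    rw [hE, he, Affine.Point.congrEquiv_some hM, WeierstrassCurve.reducesToZero_some_iff,
      not_mem_range_iff hv] at hred
    exact hred
  rcases P with _ | ⟨x, y, hxy⟩
  · rw [← Affine.Point.zero_def, map_zero, sub_zero, smul_zero, map_zero]
    exact WeierstrassCurve.reducesToZero_zero
  set σ' : L →ₐ[F] L := (σ : L →ₐ[F] L)
  have hσ₁ : ∀ z, w (σ' z) = w z := hσ
  obtain ⟨hxy', hmap⟩ : ∃ h', Affine.Point.map σ' (.some x y hxy) = .some (σ' x) (σ' y) h' :=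
    ⟨_, Affine.Point.map_some σ' hxy⟩
  rw [hmap]
  -- `P^σ` and `P^σ - P` are `ℓᵐ`-torsion as well
  have hPσm : ((ℓ ^ m : ℕ) : ℤ) • Affine.Point.some (σ' x) (σ' y) hxy' = 0 := by
    rw [← hmap, ← map_zsmul, hPm, map_zero]
  have hTm : ((ℓ ^ m : ℕ) : ℤ) • (Affine.Point.some (σ' x) (σ' y) hxy' - .some x y hxy) = 0 := by
    rw [zsmul_sub, hPσm, hPm, sub_zero]
  have hσx : w (σ' x) = w x := hσ₁ x
  by_cases hx : w x ≤ 1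
  · -- `P` integral, hence small
    have hPm' : ((ℓ ^ m : ℕ) : ℤ) • e (Affine.Point.some x y hxy) = 0 := by
      rw [← map_zsmul, hPm, map_zero]
    rw [he, Affine.Point.congrEquiv_some hM] at hPm'
    have hx1 : w x < 1 := valuation_lt_one_of_zsmul_eq_zero hT' hℓw hPm' hx
    have hσx1 : w (σ' x) < 1 := hσx ▸ hx1
    by_cases hmid : w (W.baseChange L).a₆ < w x ^ 2
    · -- non-middle: `P^σ - P` is not small (same level, same branch), hence in `E₁ ∪ {O}`
      have hns : ¬ IsSmall w (Affine.Point.some (σ' x) (σ' y) hxy' - .some x y hxy) := by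
        rcases branch hT hxy.1 hx1 hmid with ⟨hy0, -⟩ | ⟨hy1, -⟩
        · refine not_isSmall_sub_of_branch₀ hT hxy' hxy hσx hσx1 ?_ hy0
          rw [hσx, hσ₁]
          exact hy0
        · refine not_isSmall_sub_of_branch₁ hT hxy' hxy hσx hσx1 ?_ hy1
          rw [hσx, ← map_add, hσ₁]
          exact hy1
      have hred := reducesToZero_congrEquiv_of_not_isSmall hM hT' hℓw hns hTm
      rw [two_zsmul, map_add]
      exact hred.add hv hred
    · -- middle: `2P` and `2P^σ` are in `E₀`, of `ℓ`-power order, hence in `E₁ ∪ {O}`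
      rw [not_lt] at hmid
      have hmidσ : w (σ' x) ^ 2 ≤ w (W.baseChange L).a₆ := by rwa [hσx]
      have h2P : ¬ IsSmall w (Affine.Point.some x y hxy + .some x y hxy) :=
        not_isSmall_two_nsmul_of_middle hT ha₆ hxy hx1 hmid
      have h2Pσ : ¬ IsSmall w (Affine.Point.some (σ' x) (σ' y) hxy' + .some (σ' x) (σ' y) hxy') :=
        not_isSmall_two_nsmul_of_middle hT ha₆ hxy' hσx1 hmidσ
      have h2Pm : ((ℓ ^ m : ℕ) : ℤ) • (Affine.Point.some x y hxy + .some x y hxy) = 0 := by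
        rw [zsmul_add, hPm, add_zero]
      have h2Pσm : ((ℓ ^ m : ℕ) : ℤ) •
          (Affine.Point.some (σ' x) (σ' y) hxy' + .some (σ' x) (σ' y) hxy') = 0 := by
        rw [zsmul_add, hPσm, add_zero]
      have hredP := reducesToZero_congrEquiv_of_not_isSmall hM hT' hℓw h2P h2Pm
      have hredσ := reducesToZero_congrEquiv_of_not_isSmall hM hT' hℓw h2Pσ h2Pσm
      rw [zsmul_sub, two_zsmul, two_zsmul, map_sub]
      exact hredσ.sub hv hredP
  · -- `P` in the kernel of reduction: so is `P^σ`, and `E₁ ∪ {O}` is a subgroup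
    rw [not_le] at hx
    have hredP := reducesToZero_congrEquiv_some_of_one_lt hM hxy hx
    have hredσ := reducesToZero_congrEquiv_some_of_one_lt hM hxy' (hσx ▸ hx)
    have hred : M.ReducesToZero (e (Affine.Point.some (σ' x) (σ' y) hxy' - .some x y hxy)) := by
      rw [map_sub]
      exact hredσ.sub hv hredP
    rw [two_zsmul, map_add]
    exact hred.add hv hred

end TateForm

end Literature.NumberTheory.EllipticCurves

/-! ## Number fields: `(τ - 1) E[ℓᵐ]` at a potentially multiplicative place above `ℓ`, any `ℓ` -/

namespace WeierstrassCurve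

open Literature.NumberTheory.EllipticCurves Literature.NumberTheory.GaloisRepresentations Field
  IsDedekindDomain IsDedekindDomain.HeightOneSpectrum NumberField

variable {K : Type u} [Field K] [NumberField K] (W : WeierstrassCurve K)

/-- **At a potentially multiplicative place above `ℓ` (any prime `ℓ`) there is `τ ∈ Γ_K` with
`χ_ℓ(τ) ≠ 1` and `#((τ - 1) E[ℓᵐ]) ≤ ℓ^{m + 2}` for all `m`.**  As in
`exists_cyclotomicCharacter_ne_one_card_map_smul_sub_le_of_one_lt_valuation_j` (`ℓ` odd, bound
`ℓᵐ`): `τ = τ₀²` for an inertia element `τ₀` above `v` with `χ_ℓ(τ₀)² ≠ 1`; the doubles of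
`(τ - 1) E[ℓᵐ]`, transported to the Tate form of invariant `j(E)` over `K_v` by an additive
injection intertwining `τ` with an isometry of `K̄_v`, form a subgroup of the kernel of reduction
killed by `ℓᵐ` (`TateForm.one_lt_valuation_of_two_zsmul_map_sub_eq_some`), of order `≤ ℓᵐ`;
and doubling on `(τ - 1) E[ℓᵐ]` has kernel in `E[2]`, of order `4 ≤ ℓ²`.
[cite: SerreAbelianLadic1968, IV A.1.2–A.1.3] [cite: SilvermanAEC2009, X.5.4 and VII.5.5] -/
theorem exists_cyclotomicCharacter_ne_one_card_map_smul_sub_le_pow_add_two_of_one_lt_valuation_j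
    [W.IsElliptic] {v : HeightOneSpectrum (𝓞 K)} {ℓ : ℕ} [hℓ : Fact ℓ.Prime]
    (hℓv : (ℓ : 𝓞 K) ∈ v.asIdeal) (hj : 1 < v.valuation K W.j) :
    ∃ τ : absoluteGaloisGroup K, GaloisRep.cyclotomicCharacter K ℓ τ ≠ 1 ∧
      ∀ m : ℕ, Nat.card ((geomTorsion W ((ℓ ^ m : ℕ) : ℤ)).map
        (DistribSMul.toAddMonoidHom (geomPoints W) τ - AddMonoidHom.id (geomPoints W))) ≤
          ℓ ^ (m + 2) := by
  obtain ⟨𝔐, h𝔐⟩ := v.localPrimesAbove_nonempty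
  set ι : AlgebraicClosure K →ₐ[K] AlgebraicClosure (v.adicCompletion K) :=
    closureEmb (K := K) (v.adicCompletion K) with hι
  have h𝔓 : v.primeBelow ι 𝔐 ∈ v.primesAbove := HeightOneSpectrum.primeBelow_mem_primesAbove h𝔐
  -- an inertia element `τ₀` above `v` with `χ(τ₀)² ≠ 1`, and a local lift `σ₀`
  obtain ⟨τ₀, hτ₀I, hτ₀χ⟩ :=
    exists_mem_inertia_forall_cyclotomicCharacter_pow_ne_one ℓ hℓv h𝔓
  obtain ⟨σ₀, -, hσ₀⟩ :=
    IsDedekindDomain.HeightOneSpectrum.exists_mem_inertia_apply_eq_holds v ι h𝔐 hτ₀I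
  have hres₀ : resGalOfEmb ι σ₀ = τ₀ := resGalOfEmb_eq_of_apply_eq ι hσ₀
  set σ := σ₀ * σ₀ with hσdef
  set τ := resGalOfEmb ι σ with hτdef
  have hτ : τ = τ₀ * τ₀ := by rw [hτdef, hσdef, map_mul, hres₀]
  refine ⟨τ, ?_, fun m ↦ ?_⟩
  · rw [hτ, map_mul, ← sq]
    exact hτ₀χ 2 two_pos
  -- notation and the Tate form of invariant `j` over `K_v`
  obtain ⟨w, hw⟩ := v.exists_spectralValuation
  set E := v.adicCompletion K
  set L := AlgebraicClosure (v.adicCompletion K)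
  have hjw : 1 < w (algebraMap K L W.j) :=
    one_lt_spectralValuation_algebraMap_of_one_lt_valuation hw hj
  obtain ⟨hj0, hj1728, hT, ha₆, -, -⟩ := W.isTateForm_tateFormOfJ_of_one_lt hjw
  set jv : E := algebraMap K E W.j with hjv
  haveI hTell : (tateFormOfJ jv).IsElliptic := isElliptic_tateFormOfJ hj0 hj1728
  haveI : CharZero E := charZero_of_injective_algebraMap (algebraMap K E).injective
  have hjW : (W.baseChange E).j = jv := W.map_j _
  have hjE : (W.baseChange E).j = (tateFormOfJ jv).j := by
    rw [hjW, tateFormOfJ_j hj0 hj1728]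
  have hjE0 : (W.baseChange E).j ≠ 0 := by rw [hjW]; exact hj0
  have hjE1728 : (W.baseChange E).j ≠ 1728 := by rw [hjW]; exact hj1728
  -- the twisting isomorphism, intertwining squares
  obtain ⟨e, he⟩ := exists_addEquiv_baseChange_of_j_eq_map_algEquiv_sq (W.baseChange E)
    (tateFormOfJ jv) L hjE hjE0 hjE1728
  -- integrality of the Tate form
  haveI hint : ((tateFormOfJ jv).baseChange L).IsIntegral w.integer := by
    refine isIntegral_integer_of_val_le_one ?_ ?_ ?_ (hT.w_a₄_le.trans hT.w_a₆_lt.le)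
      hT.w_a₆_lt.le
    · rw [hT.a₁, map_one]
    · rw [hT.a₂, map_zero]; exact zero_le_one
    · rw [hT.a₃, map_zero]; exact zero_le_one
  set σE : L ≃ₐ[E] L := absoluteGaloisGroup.toAlgEquiv _ σ with hσE
  have hσE' : σE = absoluteGaloisGroup.toAlgEquiv _ σ₀ * absoluteGaloisGroup.toAlgEquiv _ σ₀ := by
    rw [hσE, hσdef, map_mul]
  have hσ₁ : ∀ z : L, w (σE z) = w z := fun z ↦ spectralValuation_smul hw σ z
  -- the transport `Ψ : E(K̄) → T₀(K̄_v)`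
  let Φ : localPoints W E ≃+ ((tateFormOfJ jv).baseChange L).toAffine.Point :=
    (Affine.Point.congrEquiv (baseChange_baseChange_adicCompletion W v).symm).trans e
  have hΦ : ∀ Q : localPoints W E, Φ (σ • Q) = Affine.Point.map (σE : L →ₐ[E] L) (Φ Q) := by
    intro Q
    change e (Affine.Point.congrEquiv (baseChange_baseChange_adicCompletion W v).symm (σ • Q)) =
      Affine.Point.map (σE : L →ₐ[E] L)
        (e (Affine.Point.congrEquiv (baseChange_baseChange_adicCompletion W v).symm Q))
    rw [congrEquiv_smul, ← hσE, hσE']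
    exact he _ _
  set Ψ : geomPoints W →+ ((tateFormOfJ jv).baseChange L).toAffine.Point :=
    Φ.toAddMonoidHom.comp (pointsMapOfEmb W ι) with hΨ
  have hΨinj : Function.Injective Ψ := Φ.injective.comp (pointsMapOfEmb_injective W ι)
  have hΨτ : ∀ P : geomPoints W, Ψ (τ • P) = Affine.Point.map (σE : L →ₐ[E] L) (Ψ P) := by
    intro P
    rw [hΨ, AddMonoidHom.coe_comp, Function.comp_apply, hτdef, pointsMapOfEmb_smul W ι σ P]
    exact hΦ _
  -- the subgroup `H = (τ - 1) E[ℓᵐ]`, the doubling `φ` on it, and the image `G` of `2H`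
  set f : geomPoints W →+ geomPoints W :=
    DistribSMul.toAddMonoidHom (geomPoints W) τ - AddMonoidHom.id (geomPoints W) with hf
  have hfapply : ∀ P, f P = τ • P - P := fun P ↦ rfl
  set H := (geomTorsion W ((ℓ ^ m : ℕ) : ℤ)).map f with hH
  have hℓm0 : ((ℓ ^ m : ℕ) : ℤ) ≠ 0 := by exact_mod_cast pow_ne_zero m hℓ.out.ne_zero
  haveI : Finite (geomTorsion W ((ℓ ^ m : ℕ) : ℤ)) :=
    finite_torsionPoints_holds W (AlgebraicClosure K) hℓm0
  have hHfin : (H : Set (geomPoints W)).Finite := by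
    rw [hH, AddSubgroup.coe_map]
    exact (Set.toFinite _).image f
  haveI : Finite H := hHfin.to_subtype
  set φ : H →+ geomPoints W := (zsmulAddGroupHom (2 : ℤ)).comp H.subtype with hφ
  have hφapply : ∀ Q : H, φ Q = (2 : ℤ) • (Q : geomPoints W) := fun Q ↦ rfl
  set G := φ.range.map Ψ with hG
  haveI : Finite φ.range := by
    have : (φ.range : Set (geomPoints W)).Finite := by
      rw [AddMonoidHom.coe_range]
      exact Set.finite_range _
    exact this.to_subtype
  have hGfin : (G : Set ((tateFormOfJ jv).baseChange L).toAffine.Point).Finite := by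
    rw [hG, AddSubgroup.coe_map]
    exact (Set.toFinite _).image Ψ
  haveI : Finite G := hGfin.to_subtype
  have hcardG : Nat.card φ.range = Nat.card G :=
    Nat.card_congr (φ.range.equivMapOfInjective Ψ hΨinj).toEquiv
  have hℓL : (ℓ : L) ≠ 0 := by
    rw [← map_natCast (algebraMap K L) ℓ]
    exact (map_ne_zero_iff _ (algebraMap K L).injective).mpr (Nat.cast_ne_zero.mpr hℓ.out.ne_zero)
  have hℓw : w (ℓ : L) < 1 := spectralValuation_natCast_lt_one hw hℓv
  -- the affine points of `G` lie in `E₁`, and `G` is killed by `ℓᵐ`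
  have hG1 : ∀ x y h, Affine.Point.some x y h ∈ G → 1 < w x := by
    intro x y h hmem
    obtain ⟨Q, hQ, hQeq⟩ := AddSubgroup.mem_map.mp hmem
    obtain ⟨Q', rfl⟩ := AddMonoidHom.mem_range.mp hQ
    obtain ⟨P, hP, hPQ'⟩ := AddSubgroup.mem_map.mp Q'.2
    have hP0 : ((ℓ ^ m : ℕ) : ℤ) • P = 0 := (Submodule.mem_torsionBy_iff _ P).mp hP
    have hΨP0 : ((ℓ ^ m : ℕ) : ℤ) • Ψ P = 0 := by rw [← map_zsmul, hP0, map_zero]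
    rw [hφapply, ← hPQ', hfapply, map_zsmul, map_sub, hΨτ] at hQeq
    exact TateForm.one_lt_valuation_of_two_zsmul_map_sub_eq_some (tateFormOfJ jv) hT ha₆ hℓw σE
      hσ₁ (Ψ P) hΨP0 hQeq
  have hGm : ∀ Q ∈ G, ((ℓ ^ m : ℕ) : ℤ) • Q = 0 := by
    intro Q hmem
    obtain ⟨Q₁, hQ₁, rfl⟩ := AddSubgroup.mem_map.mp hmem
    obtain ⟨Q', rfl⟩ := AddMonoidHom.mem_range.mp hQ₁
    obtain ⟨P, hP, hPQ'⟩ := AddSubgroup.mem_map.mp Q'.2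
    have hP0 : ((ℓ ^ m : ℕ) : ℤ) • P = 0 := (Submodule.mem_torsionBy_iff _ P).mp hP
    rw [hφapply, ← hPQ', ← map_zsmul Ψ, smul_comm, ← map_zsmul f, hP0, map_zero, smul_zero,
      map_zero]
  -- the kernel-of-reduction count: `#G ≤ ℓᵐ` (odd `ℓ`: Hasse invariant `A_ℓ`; `ℓ = 2`: `a₁`)
  have hcard_range : Nat.card φ.range ≤ ℓ ^ m := by
    rw [hcardG]
    rcases eq_or_ne ℓ 2 with rfl | hℓ2
    · have hA : w ((tateFormOfJ jv).baseChange L).a₁ = 1 := by rw [hT.a₁, map_one]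
      exact card_addSubgroup_le_two_pow_of_a₁ ((tateFormOfJ jv).baseChange L) hℓw
        (by exact_mod_cast hℓL) hA m G hG1 hGm
    · exact TateForm.card_addSubgroup_le_pow (tateFormOfJ jv) hT hℓ2 hℓw hℓL m G hG1 hGm
  -- the kernel of doubling on `H` embeds into `E[2]`, of order `4 ≤ ℓ²`
  have h2K : ((2 : ℕ) : AlgebraicClosure K) ≠ 0 := by
    rw [← map_natCast (algebraMap K (AlgebraicClosure K)) 2]
    exact (map_ne_zero_iff _ (algebraMap K _).injective).mpr two_ne_zero
  have hcardE2 : Nat.card (geomTorsion W ((2 : ℕ) : ℤ)) = 2 ^ 2 :=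
    (W.baseChange (AlgebraicClosure K)).card_torsionBy_eq_sq h2K
  haveI : Finite (geomTorsion W ((2 : ℕ) : ℤ)) := by
    apply Nat.finite_of_card_ne_zero
    rw [hcardE2]
    norm_num
  have hker : Nat.card φ.ker ≤ ℓ ^ 2 := by
    refine le_trans ?_ (Nat.pow_le_pow_left hℓ.out.two_le 2)
    rw [← hcardE2]
    refine Nat.card_le_card_of_injective
      (fun Q : φ.ker ↦ (⟨((Q : H) : geomPoints W), ?_⟩ : geomTorsion W ((2 : ℕ) : ℤ))) ?_
    · have hQ := Q.2
      rw [AddMonoidHom.mem_ker, hφapply] at hQ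
      exact (Submodule.mem_torsionBy_iff _ _).mpr (by exact_mod_cast hQ)
    · intro P Q hPQ
      have := congrArg Subtype.val hPQ
      exact Subtype.ext (Subtype.ext this)
  -- `#H = #ker φ · #range φ ≤ ℓ² · ℓᵐ`
  have hmul : Nat.card H = Nat.card φ.ker * Nat.card φ.range := by
    rw [AddSubgroup.card_eq_card_quotient_mul_card_addSubgroup φ.ker, mul_comm,
      Nat.card_congr (QuotientAddGroup.quotientKerEquivRange φ).toEquiv]
  rw [hmul, pow_add, mul_comm (ℓ ^ m)]
  exact Nat.mul_le_mul hker hcard_range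

end WeierstrassCurve

end
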